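import Literature.MathematicalPhysics.QuantumFieldTheory.Balaban1983to89.B9Eq324DeltaPrimeAZdPer

/-!
# `Balaban1983to89.B9Eq325QGGQInvZdPer` — [Balaban1985BackgroundPropagators] (3.25) p. 394 and Thm 3.11 p. 416 (third clause) ON THE TORUS `T_P` READ ON `ℤᵈ`:
# the multi-level averaging `Q′ : L²(T_P, ·) → L²(𝔅_P, ·)` onto LEVEL-PERIODIC multiplier data, its `τ`-adjoint `Q′*`, the operator `Q′G′(U₀)²Q′*` of the
# Lagrange-multiplier formula (3.25), its quadratic form `‖G′Q′*φ‖²`, its invertibility under the injectivity of `Q′*`, and `c(U₀) := (Q′G′²Q′*)⁻¹` as an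
# object — the periodic twin of `B9Eq325QGGQInvZd` (Dirichlet reading on a finite `Ω₀`), second link of the (3.25) chain on the torus

statement-level skeleton of published theorems with citation tags; proofs where landed; nothing here is a claim about the
Yang–Mills mass gap

`[Balaban1985BackgroundPropagators]` ("B9", CMP **99** (1985) 389–434) p. 394: *«To find λ₀ we use Lagrange multipliers and we get Rf = f − G′Q′*(Q′G′²Q′*)⁻¹Q′G′f.
(3.25) Of course this formula holds if Δ′_a, Q′G′²Q′* are invertible»*, (3.18)–(3.19) p. 393 (the multipliers on `𝔅 = ⋃_j Λ_j`, `Q′_j(U)`), p. 391 *«The adjoints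
are taken with respect to natural L² scalar products»*; Thm 3.11 p. 416 *«the operators Δ′_a, G′, Q′G′²Q′* … are positive definite … This is obvious for the first
three operators»*.  `[Balaban1985RegularSpaces]` p. 77 *«we admit the case when some domains Ω_j are equal to T_η»*.  PDF held: `paper:balaban1985-cmp99-background-propagators`
pp. 393–395, 416.

CITATION HEADER (lean-in-tree rule).  Cell `pub-ymgap` (YM Track A), DAG node N06 = [B9], width seat `pub-ymgap-dag-n06-w4` (g6), the (β′-PERIODIC) road.  WHY: the
continuity of the record's gauge-fixing projection `R(U₀)` (`projRPer`) in `U₀` — the input of the openness engine by which Thm 3.11 near the flat background is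
obtained (`B9Thm311PosDefOpenZd` at the `ℤᵈ` members) — goes through (3.25)'s explicit formula; this file types its multiplier-side objects on the torus.  Every
object is a site ∕ level stencil DEFINED FOR EVERY BACKGROUND (no proof argument depending on `U₀`), read on the periodic spaces through periodisation by
representatives; the adjointness holds on the CELL for every `U₀` with unitary averaged transporters (no periodicity of `U₀` needed), by the companion's
cell transpose `sum_box_pair_QT`.  Nothing is re-declared: `perSub ∕ formPer ∕ perRestrict`, `GpPer ∕ deltaPrimeAPer ∕ RegularPrimePer`, `fibreForm`, `QT ∕
QprimeIter ∕ bgT`, `pdelta` are imported BY NAME.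

WHAT IS DECLARED ∕ PROVED (kernel, 0 sorry; definitions with bodies + theorems; no `instance`, no `notation`).
* §1 `InSat P L Λs j y` (`ȳ ∈ Λ_j` for the level-`j` representative `ȳ ∈ [0,P∕Lʲ)ᵈ` — the periodic reading of the constraint set), ★ `levPer P L m Λs`
  (`L²(𝔅_P, ·)`: level data `φ : ℕ × ℤᵈ → 𝔸`, `(P∕Lʲ)`-periodic at level `j`, vanishing off `{j ≤ m, ȳ ∈ Λ_j}`), `levFormPer τ P L m`
  (`Σ_{j≤m} Σ_{y∈[0,P∕Lʲ)ᵈ} Re τ(φ_j(y)* ψ_j(y))`), `levFormPer_apply ∕ _isSymm ∕ _self_nonneg ∕ _self_eq_zero`, `levDelta` (the level one-class test datum),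
  ★ `levFormPer_nondegenerate`, `finiteDimensional_levPer` (`Lᵐ ∣ P`, `P ≠ 0`).
* §2 ★ `QprimeVecPer` (`Q′ = (𝟙_{Λ_j}Q′_j(U₀))_{j≤m} : L²(T_P) → L²(𝔅_P)`, read at representatives — every `U₀`), `QprimeVecPer_apply ∕ _apply_of_mem_box`,
  ★ `QprimeStarPer` (`Q′*φ = Σ_j Q′_j(U₀)ᵀφ_j` through `QT` and `perRestrict` — every `U₀`), `QprimeStarPer_coe_apply_of_mem_box`,
  ★★ `formPer_qprimeStarPer` (ADJOINTNESS `⟨Q′*φ, f⟩_{T_P} = ⟨φ, Q′f⟩_{𝔅_P}` for EVERY `U₀` with unitary averaged transporters, `Lᵐ ∣ P`, tracial Hermitian `τ`).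
* §3 ★ `qggqPer` (`Q′G′(U₀)²Q′*` with the companion's total object `G′ = GpPer`), ★★ `levFormPer_qggqPer_self` (`⟨φ, Q′G′²Q′*φ⟩ = ⟨G′Q′*φ, G′Q′*φ⟩` in the
  regime `RegularPrimePer`, `Δ′_a` symmetric), `levFormPer_qggqPer_self_nonneg`, `levFormPer_qggqPer_symm`, `QprimeStarPerInjective` (the displayed
  hypothesis «`Q′` onto»), ★★ `levFormPer_qggqPer_self_eq_zero`, ★★★ `qggqPer_bijective` (THM 3.11's third operator on the torus, in the regime).
* §4 ★ `cPer` (`(Q′G′²Q′*)⁻¹` as a total object), `cPer_qggqPer ∕ qggqPer_cPer`, ★ `levFormPer_cPer_self_pos`, `levFormPer_cPer_symm`.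
* §5 `qprimeStarPerInjective_of_single_level` (the torus members' geometry: ONE active level `j₀` — `Λ_j` empty at the representatives for `j ≠ j₀` —
  makes `Q′*` injective at every background of units), A6 `qggqPer_bijective_one_complex` (abelian fibre, `U₀ = 1`, torus constraint sets: no hypothesis left).

HONEST SCOPE.  (i) OBJECTS and finite-dimensional linear algebra; no estimate; the invertibility of `Q′G′²Q′*` is RELATIVE to the regime `RegularPrimePer`
(Δ′_a invertible — at `U₀ = 1` by the companion) and to `Q′*`-injectivity.  (ii) Unitary averaged transporters `hT` are DISPLAYED ([B7] Prop. 2's output).  (iii)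
Count-neutral; N05 ∕ N06 NOT discharged; K1⁹ `stmt-QuantumFields-27364` NOT closed; one finite `𝕋⁴` programme at fixed `ε`, Bałaban as printed; R4 closes only the
conditional finite-`𝕋⁴` rung `BalabanLadder.UV` — nothing continuum ∕ ℝ⁴ ∕ OS ∕ mass gap ∕ Clay.  Unit `pub-ymgap-dag-n06-w4` (g6), 2026-08-28.
-/

noncomputable section

namespace Literature.MathematicalPhysics.QuantumFieldTheory.Balaban1983to89.B9Eq325QGGQInvZdPer

open B7Prop1Explicit B7Eq78Linearization
open B7Prop2Explicit (unitaryUnits)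
open B8Eq119TwistedAxial (bgT)
open B8Eq138LandauZd (QprimeT QT)
open T4TermwiseTorus (IsPeriodic box mem_box tcls tlift tcls_add tcls_period tlift_mem_box tlift_tcls_of_mem_box tcls_injOn_box tcls_tlift)
open B9Eq321LandauProjectionZdPer (perSub formPer formPer_apply formPer_isSymm formPer_apply_self_eq_zero perRestrict perRestrict_mem_perSub
  finiteDimensional_perSub)
open B9Eq321LandauMultiplierIffZd (QT_add)
open B9Eq321LandauMultiplierIffZdPer (pdelta eq_pow_mul_div_of_dvd)
open B9Eq321LandauOrthogonalZdPer (sum_box_pair_QT)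
open B9Eq324DeltaPrimeAZd (fibreForm fibreForm_apply fibreForm_comm fibreForm_invariant fibreForm_nondegenerate)
open B9Eq324DeltaPrimeAZdPer (deltaPrimeAPer GpPer RegularPrimePer deltaPrimeAPer_GpPer GpPer_injective formPer_GpPer_symm QT_smul_real
  formPer_deltaPrimeAPer_symm)

-- `Site` alone could resolve to the torus sites of `Setup.lean`; re-export the `ℤ^d` sites of `B7Prop1Explicit`.
export B7Prop1Explicit (Site)

variable {d : ℕ} {𝔸 : Type*} [CStarAlgebra 𝔸]

/-- each diagonal term `Re τ(b* b)` is non-negative for a faithful positive trace. [folklore] -/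
private theorem re_trace_star_mul_self_nonneg₃ (τ : 𝔸 →ₗ[ℂ] ℂ) (hτp : ∀ a : 𝔸, a ≠ 0 → 0 < (τ (star a * a)).re) (b : 𝔸) :
    0 ≤ (τ (star b * b)).re := by
  by_cases hb : b = 0
  · rw [hb, mul_zero, map_zero, Complex.zero_re]
  · exact (hτp b hb).le

/-! ## §1  The level carrier `L²(𝔅_P, ·)`: level-periodic multiplier data on the constraint sets of the torus -/

section Carrier

variable (τ : 𝔸 →ₗ[ℂ] ℂ) (P L m : ℕ) (Λs : ℕ → Set (Site d))

/-- **THE PERIODIC READING OF A CONSTRAINT SET**: `InSat P L Λs j y` ⟺ the representative `ȳ ∈ [0,P∕Lʲ)ᵈ` of `y` modulo `P∕Lʲ` lies in `Λ_j` (for a `(P∕Lʲ)`-periodic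
`Λ_j` this is `y ∈ Λ_j`; the reading makes every level datum periodic with no hypothesis). [cite: Balaban1985BackgroundPropagators, (3.18) p.393 («𝔅 = ⋃_j Λ_j»); Balaban1985RegularSpaces, p.77 («Ω_j = T_η»)] -/
def InSat (j : ℕ) (y : Site d) : Prop := tlift (tcls (P / L ^ j) y) ∈ Λs j

omit [CStarAlgebra 𝔸] in
/-- `InSat` depends only on the class of `y`. [cite: Balaban1985RegularSpaces, p.77 (bookkeeping)] -/
theorem inSat_add_period (j : ℕ) (y n : Site d) : InSat P L Λs j (y + ((P / L ^ j : ℕ) : ℤ) • n) ↔ InSat P L Λs j y := by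
  unfold InSat
  rw [tcls_add, tcls_period, add_zero]

omit [CStarAlgebra 𝔸] in
/-- for a `(P∕Lʲ)`-periodic `Λ_j` (and `P∕Lʲ ≠ 0`), `InSat` is membership. [cite: Balaban1985RegularSpaces, p.77 (bookkeeping)] -/
theorem inSat_iff_mem {j : ℕ} [NeZero (P / L ^ j)] (hΛ : IsPeriodic (P / L ^ j) fun y => y ∈ Λs j) (y : Site d) : InSat P L Λs j y ↔ y ∈ Λs j :=
  (B9Eq321LandauMultiplierIffZdPer.mem_iff_tlift_mem_of_isPeriodic hΛ y).symm

/-- ★ **`L²(𝔅_P, ·)`**: level data `φ : ℕ × ℤᵈ → 𝔸`, `(P∕Lʲ)`-PERIODIC at each level `j`, vanishing off `{(j, y) : j ≤ m, ȳ ∈ Λ_j}` («L²(𝔅)», the target of `Q′`,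
(3.18)–(3.19), on the torus). [cite: Balaban1985BackgroundPropagators, (3.18)–(3.19) p.393, (3.24) p.394; Balaban1985RegularSpaces, p.77] -/
def levPer : Submodule ℝ (ℕ × Site d → 𝔸) where
  carrier := {φ | (∀ j, IsPeriodic (P / L ^ j) fun y => φ (j, y)) ∧ ∀ p : ℕ × Site d, ¬ (p.1 ≤ m ∧ InSat P L Λs p.1 p.2) → φ p = 0}
  add_mem' := by
    rintro φ ψ ⟨hφp, hφs⟩ ⟨hψp, hψs⟩
    refine ⟨fun j y n => ?_, fun p hp => ?_⟩
    · simp only [Pi.add_apply, hφp j y n, hψp j y n]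
    · rw [Pi.add_apply, hφs p hp, hψs p hp, add_zero]
  zero_mem' := ⟨fun _ _ _ => rfl, fun _ _ => rfl⟩
  smul_mem' := by
    rintro c φ ⟨hφp, hφs⟩
    refine ⟨fun j y n => ?_, fun p hp => ?_⟩
    · simp only [Pi.smul_apply, hφp j y n]
    · rw [Pi.smul_apply, hφs p hp, smul_zero]

/-- membership, unfolded. [cite: Balaban1985BackgroundPropagators, (3.18) p.393 (bookkeeping)] -/
theorem mem_levPer_iff (φ : ℕ × Site d → 𝔸) :
    φ ∈ levPer (𝔸 := 𝔸) P L m Λs ↔ (∀ j, IsPeriodic (P / L ^ j) fun y => φ (j, y)) ∧ ∀ p : ℕ × Site d, ¬ (p.1 ≤ m ∧ InSat P L Λs p.1 p.2) → φ p = 0 :=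
  Iff.rfl

/-- **THE PAIRING ON `L²(𝔅_P, ·)`**: `Σ_{j≤m} Σ_{y∈[0,P∕Lʲ)ᵈ} Re τ(φ_j(y)* ψ_j(y))` (one fundamental cell per level; volume weights dropped as in the sibling files).
[cite: Balaban1985BackgroundPropagators, (3.24) p.394, p.391 («natural L² scalar products»); Balaban1985RegularSpaces, p.77] -/
def levFormPer : LinearMap.BilinForm ℝ (levPer (𝔸 := 𝔸) P L m Λs) :=
  LinearMap.mk₂ ℝ (fun φ ψ => ∑ j ∈ Finset.range (m + 1), ∑ y ∈ box (d := d) (P / L ^ j),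
      (τ (star ((φ : ℕ × Site d → 𝔸) (j, y)) * (ψ : ℕ × Site d → 𝔸) (j, y))).re)
    (fun φ₁ φ₂ ψ => by
      simp only [Submodule.coe_add, Pi.add_apply, star_add, add_mul, map_add, Complex.add_re, Finset.sum_add_distrib])
    (fun c φ ψ => by
      simp only [Submodule.coe_smul, Pi.smul_apply, star_smul, star_trivial, smul_mul_assoc, smul_eq_mul, Finset.mul_sum]
      refine Finset.sum_congr rfl fun j _ => Finset.sum_congr rfl fun y _ => ?_
      rw [← Complex.coe_smul, map_smul, smul_eq_mul, Complex.re_ofReal_mul])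
    (fun φ ψ₁ ψ₂ => by
      simp only [Submodule.coe_add, Pi.add_apply, mul_add, map_add, Complex.add_re, Finset.sum_add_distrib])
    (fun c φ ψ => by
      simp only [Submodule.coe_smul, Pi.smul_apply, mul_smul_comm, smul_eq_mul, Finset.mul_sum]
      refine Finset.sum_congr rfl fun j _ => Finset.sum_congr rfl fun y _ => ?_
      rw [← Complex.coe_smul, map_smul, smul_eq_mul, Complex.re_ofReal_mul])

/-- the level pairing, unfolded. [cite: Balaban1985BackgroundPropagators, (3.24) p.394 (bookkeeping)] -/
theorem levFormPer_apply (φ ψ : levPer (𝔸 := 𝔸) P L m Λs) :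
    levFormPer τ P L m Λs φ ψ = ∑ j ∈ Finset.range (m + 1), ∑ y ∈ box (d := d) (P / L ^ j),
      (τ (star ((φ : ℕ × Site d → 𝔸) (j, y)) * (ψ : ℕ × Site d → 𝔸) (j, y))).re := rfl

/-- **SYMMETRY** of the level pairing (Hermitian `τ`). [cite: Balaban1985BackgroundPropagators, p.391] -/
theorem levFormPer_isSymm (hτs : ∀ a : 𝔸, τ (star a) = starRingEnd ℂ (τ a)) : (levFormPer τ (𝔸 := 𝔸) (d := d) P L m Λs).IsSymm :=
  ⟨fun φ ψ => by
    rw [levFormPer_apply, levFormPer_apply]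
    refine Finset.sum_congr rfl fun j _ => Finset.sum_congr rfl fun y _ => ?_
    exact fibreForm_comm τ hτs _ _⟩

/-- `⟨φ, φ⟩ ≥ 0` on `L²(𝔅_P, ·)` (faithful `τ`). [cite: Balaban1985BackgroundPropagators, p.390 («|X|² = tr X*X»)] -/
theorem levFormPer_self_nonneg (hτp : ∀ a : 𝔸, a ≠ 0 → 0 < (τ (star a * a)).re) (φ : levPer (𝔸 := 𝔸) P L m Λs) :
    0 ≤ levFormPer τ P L m Λs φ φ := by
  rw [levFormPer_apply]
  exact Finset.sum_nonneg fun j _ => Finset.sum_nonneg fun y _ => re_trace_star_mul_self_nonneg₃ τ hτp _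

variable {P L m} in
/-- the level moduli are non-zero for `Lᵐ ∣ P`, `P ≠ 0`, `j ≤ m`. [cite: Balaban1985RegularSpaces, p.77 (bookkeeping)] -/
theorem neZero_div_pow [NeZero P] (hP : L ^ m ∣ P) {j : ℕ} (hj : j ≤ m) : NeZero (P / L ^ j) :=
  ⟨fun h0 => NeZero.ne P (by rw [eq_pow_mul_div_of_dvd hP hj, h0, mul_zero])⟩

/-- **`⟨φ, φ⟩ = 0 ⟹ φ = 0` on `L²(𝔅_P, ·)`** (faithful `τ`, `Lᵐ ∣ P`, `P ≠ 0`: vanishing on each level cell + level periodicity).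
[cite: Balaban1985BackgroundPropagators, p.390 («|X|² = tr X*X»); Balaban1985RegularSpaces, p.77] -/
theorem levFormPer_self_eq_zero [NeZero P] (hτp : ∀ a : 𝔸, a ≠ 0 → 0 < (τ (star a * a)).re) (hP : L ^ m ∣ P)
    {φ : levPer (𝔸 := 𝔸) P L m Λs} (h : levFormPer τ P L m Λs φ φ = 0) : φ = 0 := by
  rw [levFormPer_apply] at h
  have hj : ∀ j ∈ Finset.range (m + 1), ∑ y ∈ box (d := d) (P / L ^ j),
      (τ (star ((φ : ℕ × Site d → 𝔸) (j, y)) * (φ : ℕ × Site d → 𝔸) (j, y))).re = 0 :=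
    (Finset.sum_eq_zero_iff_of_nonneg fun j _ => Finset.sum_nonneg fun y _ => re_trace_star_mul_self_nonneg₃ τ hτp _).1 h
  apply Subtype.ext
  funext p
  obtain ⟨j, y⟩ := p
  by_cases hjm : j ≤ m
  · haveI := neZero_div_pow (P := P) hP hjm
    have hcell := (Finset.sum_eq_zero_iff_of_nonneg fun y _ => re_trace_star_mul_self_nonneg₃ τ hτp _).1
      (hj j (Finset.mem_range.2 (Nat.lt_succ_of_le hjm))) (tlift (tcls (P / L ^ j) y)) (tlift_mem_box _)
    have hper : (φ : ℕ × Site d → 𝔸) (j, tlift (tcls (P / L ^ j) y)) = (φ : ℕ × Site d → 𝔸) (j, y) := IsPeriodic.apply_tlift (φ.2.1 j) y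
    rw [hper] at hcell
    rw [Submodule.coe_zero, Pi.zero_apply]
    by_contra hne
    exact (hτp _ hne).ne' hcell
  · exact φ.2.2 (j, y) fun h' => hjm h'.1

open Classical in
/-- **THE LEVEL ONE-CLASS TEST DATUM** at `(j₀, y₀)`: `b` on the class of `y₀` modulo `P∕L^{j₀}` at level `j₀`, `0` elsewhere — in `L²(𝔅_P, ·)` whenever `ȳ₀ ∈ Λ_{j₀}`,
`j₀ ≤ m`. [cite: Balaban1985BackgroundPropagators, (3.18) p.393 (bookkeeping)] -/
def levDelta (j₀ : ℕ) (y₀ : Site d) (b : 𝔸) : ℕ × Site d → 𝔸 := fun p => if p.1 = j₀ then pdelta (P / L ^ j₀) y₀ b p.2 else 0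

/-- the test datum lies in `L²(𝔅_P, ·)`. [cite: Balaban1985BackgroundPropagators, (3.18) p.393 (bookkeeping)] -/
theorem levDelta_mem {j₀ : ℕ} (hj₀ : j₀ ≤ m) {y₀ : Site d} (hy₀ : InSat P L Λs j₀ y₀) (b : 𝔸) :
    levDelta P L j₀ y₀ b ∈ levPer (𝔸 := 𝔸) P L m Λs := by
  classical
  refine ⟨fun j y n => ?_, fun p hp => ?_⟩
  · by_cases hj : j = j₀
    · subst hj
      simp only [levDelta, pdelta, if_true, tcls_add, tcls_period, add_zero]
    · simp [levDelta, hj]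
  · obtain ⟨j, y⟩ := p
    by_cases hj : j = j₀
    · subst hj
      have hy : tcls (P / L ^ j) y ≠ tcls (P / L ^ j) y₀ := by
        intro hy
        apply hp
        refine ⟨hj₀, ?_⟩
        unfold InSat at hy₀ ⊢
        rw [hy]
        exact hy₀
      simp [levDelta, pdelta, hy]
    · simp [levDelta, hj]

/-- ★ **NON-DEGENERACY OF THE LEVEL PAIRING** (faithful Hermitian `τ`, `Lᵐ ∣ P`, `P ≠ 0`): test against the level one-class data at `(j, ȳ)`.
[cite: Balaban1985BackgroundPropagators, (3.24) p.394 («natural L² scalar products»); Balaban1985RegularSpaces, p.77] -/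
theorem levFormPer_nondegenerate [NeZero P] (hτs : ∀ a : 𝔸, τ (star a) = starRingEnd ℂ (τ a))
    (hτp : ∀ a : 𝔸, a ≠ 0 → 0 < (τ (star a * a)).re) (hP : L ^ m ∣ P) :
    (levFormPer τ (𝔸 := 𝔸) (d := d) P L m Λs).Nondegenerate := by
  classical
  have hleft : ∀ φ : levPer (𝔸 := 𝔸) P L m Λs, (∀ ψ, levFormPer τ P L m Λs φ ψ = 0) → φ = 0 := by
    intro φ hφ
    apply Subtype.ext
    funext p
    obtain ⟨j, y⟩ := p
    rw [Submodule.coe_zero, Pi.zero_apply]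
    by_cases hjy : j ≤ m ∧ InSat P L Λs j y
    · haveI := neZero_div_pow (P := P) hP hjy.1
      -- pass to the representative `ȳ`
      have hper : (φ : ℕ × Site d → 𝔸) (j, tlift (tcls (P / L ^ j) y)) = (φ : ℕ × Site d → 𝔸) (j, y) := IsPeriodic.apply_tlift (φ.2.1 j) y
      rw [← hper]
      have hsat : InSat P L Λs j (tlift (tcls (P / L ^ j) y)) := by
        unfold InSat
        rw [tcls_tlift]
        exact hjy.2
      refine (fibreForm_nondegenerate τ hτp).1 _ fun b => ?_
      have h := hφ ⟨levDelta P L j (tlift (tcls (P / L ^ j) y)) b, levDelta_mem P L m Λs hjy.1 hsat b⟩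
      rw [levFormPer_apply, Finset.sum_eq_single j (fun j' _ hj' => by
          refine Finset.sum_eq_zero fun y' _ => ?_
          simp [levDelta, hj'])
        (fun hj' => absurd (Finset.mem_range.2 (Nat.lt_succ_of_le hjy.1)) hj')] at h
      have h2 : ∑ y' ∈ box (d := d) (P / L ^ j),
          (τ (star ((φ : ℕ × Site d → 𝔸) (j, y')) * pdelta (P / L ^ j) (tlift (tcls (P / L ^ j) y)) b y')).re = 0 := by
        simpa [levDelta] using h
      rw [← Complex.re_sum, B9Eq321LandauMultiplierIffZdPer.sum_box_trace_mul_pdelta τ (P / L ^ j)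
        (fun y' => star ((φ : ℕ × Site d → 𝔸) (j, y'))) (tlift_mem_box _) b] at h2
      rw [fibreForm_apply]
      exact h2
    · exact φ.2.2 (j, y) hjy
  refine ⟨hleft, fun ψ hψ => hleft ψ fun φ => ?_⟩
  rw [(levFormPer_isSymm τ P L m Λs hτs).eq ψ φ]
  exact hψ φ

/-- **`L²(𝔅_P, ·)` IS FINITE-DIMENSIONAL** (`Lᵐ ∣ P`, `P ≠ 0`, finite-dimensional fibre): restriction to the finitely many cells `⋃_{j≤m} {j} × [0,P∕Lʲ)ᵈ` is injective.
[cite: Balaban1985BackgroundPropagators, (3.18) p.393 («𝔅»); Balaban1985RegularSpaces, p.77] -/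
theorem finiteDimensional_levPer [FiniteDimensional ℝ 𝔸] [NeZero P] (hP : L ^ m ∣ P) : FiniteDimensional ℝ (levPer (𝔸 := 𝔸) (d := d) P L m Λs) := by
  classical
  let B : Finset (ℕ × Site d) := (Finset.range (m + 1)).biUnion fun j => (box (d := d) (P / L ^ j)).image (Prod.mk j)
  let res : levPer (𝔸 := 𝔸) (d := d) P L m Λs →ₗ[ℝ] ((↥B) → 𝔸) :=
    { toFun := fun φ p => (φ : ℕ × Site d → 𝔸) p.1
      map_add' := fun φ ψ => rfl
      map_smul' := fun c φ => rfl }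
  refine FiniteDimensional.of_injective res fun φ ψ h => ?_
  apply Subtype.ext
  funext p
  obtain ⟨j, y⟩ := p
  by_cases hjm : j ≤ m
  · haveI := neZero_div_pow (P := P) hP hjm
    have hpB : (j, tlift (tcls (P / L ^ j) y)) ∈ B := by
      rw [Finset.mem_biUnion]
      exact ⟨j, Finset.mem_range.2 (Nat.lt_succ_of_le hjm), Finset.mem_image.2 ⟨_, tlift_mem_box _, rfl⟩⟩
    have hφ : (φ : ℕ × Site d → 𝔸) (j, tlift (tcls (P / L ^ j) y)) = (φ : ℕ × Site d → 𝔸) (j, y) := IsPeriodic.apply_tlift (φ.2.1 j) y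
    have hψ : (ψ : ℕ × Site d → 𝔸) (j, tlift (tcls (P / L ^ j) y)) = (ψ : ℕ × Site d → 𝔸) (j, y) := IsPeriodic.apply_tlift (ψ.2.1 j) y
    rw [← hφ, ← hψ]
    exact congr_fun h ⟨_, hpB⟩
  · rw [φ.2.2 (j, y) fun h' => hjm h'.1, ψ.2.2 (j, y) fun h' => hjm h'.1]

end Carrier

/-! ## §2  `Q′ : L²(T_P, ·) → L²(𝔅_P, ·)`, its adjoint `Q′*`, and the adjointness identity on the cell -/

section Averaging

variable (τ : 𝔸 →ₗ[ℂ] ℂ) (P L : ℕ) (U₀ : Site d → Fin d → 𝔸ˣ) (m : ℕ) (Λs : ℕ → Set (Site d))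

open Classical in
/-- ★ **`Q′ = (𝟙_{Λ_j}Q′_j(U₀))_{j ≤ m} : L²(T_P, ·) → L²(𝔅_P, ·)`** — the multi-level averaging onto the constraint sets ((3.18)–(3.19)), READ AT REPRESENTATIVES:
`(Q′f)_j(y) := (Q′_j(U₀)f)(ȳ)` for `j ≤ m`, `ȳ ∈ Λ_j`, else `0` — level-periodic by construction for EVERY background `U₀` (on periodic data at a periodic `U₀` it is
`Q′_j(U₀)f` itself, `QprimeVecPer_apply_of_mem_box`). [cite: Balaban1985BackgroundPropagators, (3.18)–(3.19) p.393, (3.21) p.394; Balaban1985RegularSpaces, p.77] -/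
def QprimeVecPer : perSub (𝔸 := 𝔸) (d := d) P →ₗ[ℝ] levPer (𝔸 := 𝔸) (d := d) P L m Λs where
  toFun f := ⟨fun p => if p.1 ≤ m ∧ InSat P L Λs p.1 p.2 then
      QprimeIter (zdBlocking d L) (bgT L U₀) p.1 (f : Site d → 𝔸) (tlift (tcls (P / L ^ p.1) p.2)) else 0,
    ⟨fun j y n => by
      simp only [inSat_add_period, tcls_add, tcls_period, add_zero], fun p hp => if_neg hp⟩⟩
  map_add' f g := by
    apply Subtype.ext
    funext p
    simp only [Submodule.coe_add, Pi.add_apply]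
    split_ifs with h
    · exact congr_fun (QprimeIter_add (zdBlocking d L) (bgT L U₀) (f : Site d → 𝔸) (g : Site d → 𝔸) p.1) _
    · rw [add_zero]
  map_smul' c f := by
    apply Subtype.ext
    funext p
    simp only [Submodule.coe_smul, Pi.smul_apply, RingHom.id_apply]
    split_ifs with h
    · have := congr_fun ((B9Eq324DeltaPrimeAZd.QprimeLin L U₀ p.1).map_smul c (f : Site d → 𝔸)) (tlift (tcls (P / L ^ p.1) p.2))
      simpa only [B9Eq324DeltaPrimeAZd.QprimeLin_apply, Pi.smul_apply] using this
    · rw [smul_zero]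

open Classical in
/-- `Q′f`, unfolded. [cite: Balaban1985BackgroundPropagators, (3.19) p.393 (bookkeeping)] -/
theorem QprimeVecPer_apply (f : perSub (𝔸 := 𝔸) (d := d) P) (j : ℕ) (y : Site d) :
    (QprimeVecPer P L U₀ m Λs f : ℕ × Site d → 𝔸) (j, y) =
      if j ≤ m ∧ InSat P L Λs j y then QprimeIter (zdBlocking d L) (bgT L U₀) j (f : Site d → 𝔸) (tlift (tcls (P / L ^ j) y)) else 0 := by
  classical
  rfl

/-- **`Q′f` ON THE LEVEL CELL**: for `j ≤ m`, `y ∈ [0,P∕Lʲ)ᵈ` with `ȳ = y ∈ Λ_j`, `(Q′f)_j(y) = (Q′_j(U₀)f)(y)` — every `U₀`, every `f`.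
[cite: Balaban1985BackgroundPropagators, (3.19) p.393] -/
theorem QprimeVecPer_apply_of_mem_box (f : perSub (𝔸 := 𝔸) (d := d) P) {j : ℕ} (hj : j ≤ m) {y : Site d} [NeZero (P / L ^ j)]
    (hy : y ∈ box (d := d) (P / L ^ j)) (hsat : InSat P L Λs j y) :
    (QprimeVecPer P L U₀ m Λs f : ℕ × Site d → 𝔸) (j, y) = QprimeIter (zdBlocking d L) (bgT L U₀) j (f : Site d → 𝔸) y := by
  rw [QprimeVecPer_apply, if_pos ⟨hj, hsat⟩, tlift_tcls_of_mem_box hy]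

/-- `Q′f` vanishes off the constraint data. [cite: Balaban1985BackgroundPropagators, (3.19) p.393 (bookkeeping)] -/
theorem QprimeVecPer_apply_of_not (f : perSub (𝔸 := 𝔸) (d := d) P) {j : ℕ} {y : Site d} (h : ¬ (j ≤ m ∧ InSat P L Λs j y)) :
    (QprimeVecPer P L U₀ m Λs f : ℕ × Site d → 𝔸) (j, y) = 0 := by
  rw [QprimeVecPer_apply, if_neg h]

/-- ★ **`Q′* : L²(𝔅_P, ·) → L²(T_P, ·)`, `Q′*φ = Σ_{j≤m} Q′_j(U₀)ᵀφ_j`** — the explicit transpose stencil `QT` of the B8 lineage applied to the level data (constraint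
indicator already carried by `φ`), read on the torus through `perRestrict` — for EVERY background `U₀`. [cite: Balaban1985BackgroundPropagators, (3.25) p.394 («Q′*»), (3.19) p.393, p.391 («the adjoints …»)] -/
def QprimeStarPer : levPer (𝔸 := 𝔸) (d := d) P L m Λs →ₗ[ℝ] perSub (𝔸 := 𝔸) (d := d) P where
  toFun φ := ⟨perRestrict P (QT L m (fun _ => (Set.univ : Set (Site d))) U₀ (fun j y => (φ : ℕ × Site d → 𝔸) (j, y))),
    perRestrict_mem_perSub P _⟩
  map_add' φ ψ := by
    apply Subtype.ext
    funext x
    have h : (fun j y => (φ : ℕ × Site d → 𝔸) (j, y) + (ψ : ℕ × Site d → 𝔸) (j, y)) =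
        (fun j y => (φ : ℕ × Site d → 𝔸) (j, y)) + fun j y => (ψ : ℕ × Site d → 𝔸) (j, y) := rfl
    simp only [Submodule.coe_add, Pi.add_apply, perRestrict]
    rw [h, QT_add]
  map_smul' c φ := by
    apply Subtype.ext
    funext x
    have h : (fun j y => c • (φ : ℕ × Site d → 𝔸) (j, y)) = c • fun j y => (φ : ℕ × Site d → 𝔸) (j, y) := rfl
    simp only [Submodule.coe_smul, Pi.smul_apply, perRestrict, RingHom.id_apply]
    rw [h, QT_smul_real]

/-- `Q′*φ`, unfolded. [cite: Balaban1985BackgroundPropagators, (3.25) p.394 (bookkeeping)] -/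
theorem QprimeStarPer_coe (φ : levPer (𝔸 := 𝔸) (d := d) P L m Λs) :
    (QprimeStarPer P L U₀ m Λs φ : Site d → 𝔸) = perRestrict P (QT L m (fun _ => (Set.univ : Set (Site d))) U₀ (fun j y => (φ : ℕ × Site d → 𝔸) (j, y))) :=
  rfl

/-- `Q′*φ` ON THE CELL is the stencil, every `U₀`. [cite: Balaban1985BackgroundPropagators, (3.25) p.394 (bookkeeping)] -/
theorem QprimeStarPer_coe_apply_of_mem_box [NeZero P] (φ : levPer (𝔸 := 𝔸) (d := d) P L m Λs) {x : Site d} (hx : x ∈ box (d := d) P) :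
    (QprimeStarPer P L U₀ m Λs φ : Site d → 𝔸) x = QT L m (fun _ => (Set.univ : Set (Site d))) U₀ (fun j y => (φ : ℕ × Site d → 𝔸) (j, y)) x := by
  simp only [QprimeStarPer_coe, perRestrict, tlift_tcls_of_mem_box hx]

variable {P L U₀ m Λs}

/-- ★★ **ADJOINTNESS ON THE CELL: `⟨Q′*φ, f⟩_{T_P} = ⟨φ, Q′f⟩_{𝔅_P}`** for EVERY background `U₀` whose averaged transporters `Ū₀ʲ(Γ)` are unitary, `Lᵐ ∣ P`, `P ≠ 0`,
tracial Hermitian `τ` — the companion's cell transpose identity `sum_box_pair_QT` for the pairing `Re τ(a*b)`; NO periodicity of `U₀` or `f` is needed.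
[cite: Balaban1985BackgroundPropagators, (3.25) p.394, p.391 («The adjoints are taken with respect to natural L² scalar products»), (3.19) p.393] -/
theorem formPer_qprimeStarPer [NeZero P] [NeZero L] (hτt : ∀ a b : 𝔸, τ (a * b) = τ (b * a)) (hτs : ∀ a : 𝔸, τ (star a) = starRingEnd ℂ (τ a))
    (hT : ∀ (j : ℕ) (z y : Site d), bgT L U₀ j z y ∈ unitaryUnits 𝔸) (hP : L ^ m ∣ P)
    (φ : levPer (𝔸 := 𝔸) (d := d) P L m Λs) (f : perSub (𝔸 := 𝔸) (d := d) P) :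
    formPer τ P (QprimeStarPer P L U₀ m Λs φ) f = levFormPer τ P L m Λs φ (QprimeVecPer P L U₀ m Λs f) := by
  rw [formPer_apply, levFormPer_apply]
  have h1 : ∀ x ∈ box (d := d) P, (τ (star ((QprimeStarPer P L U₀ m Λs φ : Site d → 𝔸) x) * (f : Site d → 𝔸) x)).re =
      fibreForm τ ((f : Site d → 𝔸) x) (QT L m (fun _ => (Set.univ : Set (Site d))) U₀ (fun j y => (φ : ℕ × Site d → 𝔸) (j, y)) x) := by
    intro x hx
    rw [QprimeStarPer_coe_apply_of_mem_box P L U₀ m Λs φ hx, ← fibreForm_apply, fibreForm_comm τ hτs]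
  rw [Finset.sum_congr rfl h1, sum_box_pair_QT (fibreForm τ) (unitaryUnits 𝔸) L U₀ (fibreForm_invariant τ hτt) hT hP (f : Site d → 𝔸)
    (fun _ => (Set.univ : Set (Site d))) (fun j y => (φ : ℕ × Site d → 𝔸) (j, y))]
  refine Finset.sum_congr rfl fun j hj => Finset.sum_congr rfl fun y hy => ?_
  have hjm : j ≤ m := Nat.lt_succ_iff.1 (Finset.mem_range.1 hj)
  haveI := neZero_div_pow (P := P) hP hjm
  rw [Set.indicator_univ, fibreForm_comm τ hτs, fibreForm_apply]
  by_cases hsat : InSat P L Λs j y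
  · rw [QprimeVecPer_apply_of_mem_box P L U₀ m Λs f hjm hy hsat]
  · rw [QprimeVecPer_apply_of_not P L U₀ m Λs f (fun h => hsat h.2), φ.2.2 (j, y) (fun h => hsat h.2)]
    simp

end Averaging

/-! ## §3  `Q′G′(U₀)²Q′*` on `L²(𝔅_P, ·)` and its quadratic form `‖G′Q′*φ‖²`; invertibility -/

section QGGQ

variable (τ : 𝔸 →ₗ[ℂ] ℂ) (P L : ℕ) (U₀ : Site d → Fin d → 𝔸ˣ) (η : ℝ) (m : ℕ) (a : ℕ → ℝ) (Λs : ℕ → Set (Site d))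

/-- ★ **`Q′G′(U₀)²Q′*` ON `L²(𝔅_P, ·)`** with the companion's TOTAL object `G′(U₀) = GpPer` (the genuine inverse in the regime `RegularPrimePer`, `0` off it) — for
every background `U₀`. [cite: Balaban1985BackgroundPropagators, (3.25) p.394] -/
def qggqPer : levPer (𝔸 := 𝔸) (d := d) P L m Λs →ₗ[ℝ] levPer (𝔸 := 𝔸) (d := d) P L m Λs :=
  (QprimeVecPer P L U₀ m Λs).comp ((GpPer L U₀ η m a Λs P).comp ((GpPer L U₀ η m a Λs P).comp (QprimeStarPer P L U₀ m Λs)))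

/-- `Q′G′²Q′*φ`, unfolded. [cite: Balaban1985BackgroundPropagators, (3.25) p.394 (bookkeeping)] -/
theorem qggqPer_apply (φ : levPer (𝔸 := 𝔸) (d := d) P L m Λs) :
    qggqPer P L U₀ η m a Λs φ = QprimeVecPer P L U₀ m Λs (GpPer L U₀ η m a Λs P (GpPer L U₀ η m a Λs P (QprimeStarPer P L U₀ m Λs φ))) := rfl

variable {P L U₀ η m a Λs} [NeZero P] [NeZero L]

/-- ★★ **`⟨φ, Q′G′²Q′*φ⟩ = ⟨G′Q′*φ, G′Q′*φ⟩`** in the regime (`Δ′_a(U₀)` invertible), at a unitary periodic `U₀` with unitary averaged transporters (so that `Δ′_a`, hence `G′`,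
is symmetric), `Lᵐ ∣ P`, tracial Hermitian `τ` — adjointness of `Q′ ∕ Q′*` and symmetry of `G′`.
[cite: Balaban1985BackgroundPropagators, (3.25) p.394, Thm 3.11 p.416 («positive definite. This is obvious»)] -/
theorem levFormPer_qggqPer_self (hτt : ∀ a b : 𝔸, τ (a * b) = τ (b * a)) (hτs : ∀ a : 𝔸, τ (star a) = starRingEnd ℂ (τ a))
    (hUu : ∀ (x : Site d) (κ : Fin d), U₀ x κ ∈ unitaryUnits 𝔸) (hT : ∀ (j : ℕ) (z y : Site d), bgT L U₀ j z y ∈ unitaryUnits 𝔸)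
    (hU : IsPeriodic P U₀) (hP : L ^ m ∣ P) (hreg : RegularPrimePer L U₀ η m a Λs P) (φ : levPer (𝔸 := 𝔸) (d := d) P L m Λs) :
    levFormPer τ P L m Λs φ (qggqPer P L U₀ η m a Λs φ) =
      formPer τ P (GpPer L U₀ η m a Λs P (QprimeStarPer P L U₀ m Λs φ)) (GpPer L U₀ η m a Λs P (QprimeStarPer P L U₀ m Λs φ)) := by
  rw [qggqPer_apply, ← formPer_qprimeStarPer τ hτt hτs hT hP,
    formPer_GpPer_symm τ hτs hreg (fun f g => formPer_deltaPrimeAPer_symm τ hτt hτs hUu hT hU hP f g)]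

/-- **`⟨φ, Q′G′²Q′*φ⟩ ≥ 0`** (same hypotheses, faithful `τ`). [cite: Balaban1985BackgroundPropagators, Thm 3.11 p.416] -/
theorem levFormPer_qggqPer_self_nonneg (hτt : ∀ a b : 𝔸, τ (a * b) = τ (b * a)) (hτs : ∀ a : 𝔸, τ (star a) = starRingEnd ℂ (τ a))
    (hτp : ∀ a : 𝔸, a ≠ 0 → 0 < (τ (star a * a)).re)
    (hUu : ∀ (x : Site d) (κ : Fin d), U₀ x κ ∈ unitaryUnits 𝔸) (hT : ∀ (j : ℕ) (z y : Site d), bgT L U₀ j z y ∈ unitaryUnits 𝔸)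
    (hU : IsPeriodic P U₀) (hP : L ^ m ∣ P) (hreg : RegularPrimePer L U₀ η m a Λs P) (φ : levPer (𝔸 := 𝔸) (d := d) P L m Λs) :
    0 ≤ levFormPer τ P L m Λs φ (qggqPer P L U₀ η m a Λs φ) := by
  rw [levFormPer_qggqPer_self τ hτt hτs hUu hT hU hP hreg, formPer_apply]
  exact Finset.sum_nonneg fun x _ => re_trace_star_mul_self_nonneg₃ τ hτp _

/-- **`Q′G′²Q′*` IS SYMMETRIC for the level pairing** (same hypotheses). [cite: Balaban1985BackgroundPropagators, (3.25) p.394] -/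
theorem levFormPer_qggqPer_symm (hτt : ∀ a b : 𝔸, τ (a * b) = τ (b * a)) (hτs : ∀ a : 𝔸, τ (star a) = starRingEnd ℂ (τ a))
    (hUu : ∀ (x : Site d) (κ : Fin d), U₀ x κ ∈ unitaryUnits 𝔸) (hT : ∀ (j : ℕ) (z y : Site d), bgT L U₀ j z y ∈ unitaryUnits 𝔸)
    (hU : IsPeriodic P U₀) (hP : L ^ m ∣ P) (hreg : RegularPrimePer L U₀ η m a Λs P) (φ ψ : levPer (𝔸 := 𝔸) (d := d) P L m Λs) :
    levFormPer τ P L m Λs φ (qggqPer P L U₀ η m a Λs ψ) = levFormPer τ P L m Λs ψ (qggqPer P L U₀ η m a Λs φ) := by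
  have hGs := formPer_GpPer_symm τ hτs hreg (fun f g => formPer_deltaPrimeAPer_symm τ hτt hτs hUu hT hU hP f g) (a := a) (η := η)
  rw [qggqPer_apply, qggqPer_apply, ← formPer_qprimeStarPer τ hτt hτs hT hP, ← formPer_qprimeStarPer τ hτt hτs hT hP]
  set G := GpPer (𝔸 := 𝔸) (d := d) L U₀ η m a Λs P
  set u := QprimeStarPer P L U₀ m Λs φ
  set v := QprimeStarPer P L U₀ m Λs ψ
  rw [← hGs u (G v), (formPer_isSymm τ P hτs).eq (G u) (G v), hGs v (G u)]

variable (P L U₀ m Λs) in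
/-- **THE DISPLAYED HYPOTHESIS — «`Q′` IS ONTO» = `Q′*` INJECTIVE ON `L²(𝔅_P, ·)`** (on the torus members — one active level — it holds at every background of units,
§5). [cite: Balaban1985BackgroundPropagators, (3.18)–(3.19) p.393, (3.25) p.394] -/
def QprimeStarPerInjective : Prop := Function.Injective (QprimeStarPer (𝔸 := 𝔸) (d := d) P L U₀ m Λs)

/-- ★★ **`⟨φ, Q′G′²Q′*φ⟩ = 0 ⟹ φ = 0`** when `Q′*` is injective (in the regime): `‖G′Q′*φ‖² = 0 ⟹ G′Q′*φ = 0 ⟹ Q′*φ = 0 ⟹ φ = 0`.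
[cite: Balaban1985BackgroundPropagators, Thm 3.11 p.416 («(Q′G′²Q′*)⁻¹ … positive definite. This is obvious»)] -/
theorem levFormPer_qggqPer_self_eq_zero (hτt : ∀ a b : 𝔸, τ (a * b) = τ (b * a)) (hτs : ∀ a : 𝔸, τ (star a) = starRingEnd ℂ (τ a))
    (hτp : ∀ a : 𝔸, a ≠ 0 → 0 < (τ (star a * a)).re)
    (hUu : ∀ (x : Site d) (κ : Fin d), U₀ x κ ∈ unitaryUnits 𝔸) (hT : ∀ (j : ℕ) (z y : Site d), bgT L U₀ j z y ∈ unitaryUnits 𝔸)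
    (hU : IsPeriodic P U₀) (hP : L ^ m ∣ P) (hreg : RegularPrimePer L U₀ η m a Λs P) (hinj : QprimeStarPerInjective P L U₀ m Λs)
    {φ : levPer (𝔸 := 𝔸) (d := d) P L m Λs} (h0 : levFormPer τ P L m Λs φ (qggqPer P L U₀ η m a Λs φ) = 0) : φ = 0 := by
  rw [levFormPer_qggqPer_self τ hτt hτs hUu hT hU hP hreg] at h0
  have hG : GpPer L U₀ η m a Λs P (QprimeStarPer P L U₀ m Λs φ) = 0 := formPer_apply_self_eq_zero τ P hτp h0
  have hQ : QprimeStarPer P L U₀ m Λs φ = 0 := GpPer_injective hreg (by rw [hG, map_zero])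
  exact hinj (by rw [hQ, map_zero])

/-- ★★★ **THEOREM 3.11, THIRD OPERATOR, ON THE TORUS: `Q′G′(U₀)²Q′*` IS INVERTIBLE ON `L²(𝔅_P, ·)`** in the regime, at a unitary periodic `U₀` with unitary averaged
transporters, given the injectivity of `Q′*` (`Lᵐ ∣ P`, `P ≠ 0`, tracial Hermitian faithful `τ`, finite-dimensional fibre) — positive definite ⟹ injective ⟹ bijective.
[cite: Balaban1985BackgroundPropagators, Thm 3.11 p.416, (3.25) p.394 («if Δ′_a, Q′G′²Q′* are invertible. It will be proved later»)] -/
theorem qggqPer_bijective [FiniteDimensional ℝ 𝔸] (hτt : ∀ a b : 𝔸, τ (a * b) = τ (b * a)) (hτs : ∀ a : 𝔸, τ (star a) = starRingEnd ℂ (τ a))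
    (hτp : ∀ a : 𝔸, a ≠ 0 → 0 < (τ (star a * a)).re)
    (hUu : ∀ (x : Site d) (κ : Fin d), U₀ x κ ∈ unitaryUnits 𝔸) (hT : ∀ (j : ℕ) (z y : Site d), bgT L U₀ j z y ∈ unitaryUnits 𝔸)
    (hU : IsPeriodic P U₀) (hP : L ^ m ∣ P) (hreg : RegularPrimePer L U₀ η m a Λs P) (hinj : QprimeStarPerInjective P L U₀ m Λs) :
    Function.Bijective (qggqPer (𝔸 := 𝔸) (d := d) P L U₀ η m a Λs) := by
  haveI := finiteDimensional_levPer (𝔸 := 𝔸) (d := d) P L m Λs hP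
  have hinj' : Function.Injective (qggqPer (𝔸 := 𝔸) (d := d) P L U₀ η m a Λs) := by
    rw [← LinearMap.ker_eq_bot, Submodule.eq_bot_iff]
    intro φ hφ
    rw [LinearMap.mem_ker] at hφ
    refine levFormPer_qggqPer_self_eq_zero τ hτt hτs hτp hUu hT hU hP hreg hinj ?_
    rw [hφ, map_zero]
  exact ⟨hinj', LinearMap.injective_iff_surjective.1 hinj'⟩

end QGGQ

/-! ## §4  `c(U₀) := (Q′G′²Q′*)⁻¹` as a total object -/

section Inverse

variable (τ : 𝔸 →ₗ[ℂ] ℂ) (P L : ℕ) (U₀ : Site d → Fin d → 𝔸ˣ) (η : ℝ) (m : ℕ) (a : ℕ → ℝ) (Λs : ℕ → Set (Site d))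

open Classical in
/-- ★ **`c(U₀) := (Q′G′(U₀)²Q′*)⁻¹` AS A TOTAL OBJECT** on `L²(𝔅_P, ·)`: the inverse linear map where `Q′G′²Q′*` is bijective, `0` otherwise — every `U₀`.
[cite: Balaban1985BackgroundPropagators, (3.25) p.394, Thm 3.11 p.416] -/
def cPer : levPer (𝔸 := 𝔸) (d := d) P L m Λs →ₗ[ℝ] levPer (𝔸 := 𝔸) (d := d) P L m Λs :=
  if h : Function.Bijective (qggqPer (𝔸 := 𝔸) (d := d) P L U₀ η m a Λs) then
    ((LinearEquiv.ofBijective (qggqPer P L U₀ η m a Λs) h).symm : levPer (𝔸 := 𝔸) (d := d) P L m Λs →ₗ[ℝ] levPer (𝔸 := 𝔸) (d := d) P L m Λs)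
  else 0

variable {P L U₀ η m a Λs}

/-- **`c (Q′G′²Q′* φ) = φ`.** [cite: Balaban1985BackgroundPropagators, (3.25) p.394] -/
theorem cPer_qggqPer (h : Function.Bijective (qggqPer (𝔸 := 𝔸) (d := d) P L U₀ η m a Λs)) (φ : levPer (𝔸 := 𝔸) (d := d) P L m Λs) :
    cPer P L U₀ η m a Λs (qggqPer P L U₀ η m a Λs φ) = φ := by
  rw [cPer, dif_pos h, LinearEquiv.coe_coe, ← LinearEquiv.ofBijective_apply (hf := h), LinearEquiv.symm_apply_apply]

/-- **`Q′G′²Q′* (c φ) = φ`.** [cite: Balaban1985BackgroundPropagators, (3.25) p.394] -/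
theorem qggqPer_cPer (h : Function.Bijective (qggqPer (𝔸 := 𝔸) (d := d) P L U₀ η m a Λs)) (φ : levPer (𝔸 := 𝔸) (d := d) P L m Λs) :
    qggqPer P L U₀ η m a Λs (cPer P L U₀ η m a Λs φ) = φ := by
  rw [cPer, dif_pos h, LinearEquiv.coe_coe, ← LinearEquiv.ofBijective_apply (hf := h), LinearEquiv.apply_symm_apply]

/-- `c = 0` off the regime (total-object convention). [cite: Balaban1985BackgroundPropagators, (3.25) p.394 (bookkeeping)] -/
theorem cPer_of_not (h : ¬ Function.Bijective (qggqPer (𝔸 := 𝔸) (d := d) P L U₀ η m a Λs)) : cPer (𝔸 := 𝔸) (d := d) P L U₀ η m a Λs = 0 := by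
  rw [cPer, dif_neg h]

variable [NeZero P] [NeZero L]

/-- ★ **`c(U₀)` IS POSITIVE DEFINITE**: `⟨cφ, φ⟩ = ⟨cφ, Q′G′²Q′*(cφ)⟩ = ‖G′Q′*cφ‖² > 0` for `φ ≠ 0` («(Q′G′²Q′*)⁻¹ … positive definite»).
[cite: Balaban1985BackgroundPropagators, Thm 3.11 p.416] -/
theorem levFormPer_cPer_self_pos [FiniteDimensional ℝ 𝔸] (hτt : ∀ a b : 𝔸, τ (a * b) = τ (b * a)) (hτs : ∀ a : 𝔸, τ (star a) = starRingEnd ℂ (τ a))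
    (hτp : ∀ a : 𝔸, a ≠ 0 → 0 < (τ (star a * a)).re)
    (hUu : ∀ (x : Site d) (κ : Fin d), U₀ x κ ∈ unitaryUnits 𝔸) (hT : ∀ (j : ℕ) (z y : Site d), bgT L U₀ j z y ∈ unitaryUnits 𝔸)
    (hU : IsPeriodic P U₀) (hP : L ^ m ∣ P) (hreg : RegularPrimePer L U₀ η m a Λs P) (hinj : QprimeStarPerInjective P L U₀ m Λs)
    {φ : levPer (𝔸 := 𝔸) (d := d) P L m Λs} (hφ : φ ≠ 0) :
    0 < levFormPer τ P L m Λs (cPer P L U₀ η m a Λs φ) φ := by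
  have hb := qggqPer_bijective τ hτt hτs hτp hUu hT hU hP hreg hinj (η := η) (a := a)
  have hne : cPer P L U₀ η m a Λs φ ≠ 0 := by
    intro h0
    apply hφ
    have := congrArg (qggqPer P L U₀ η m a Λs) h0
    rwa [qggqPer_cPer hb, map_zero] at this
  have key : levFormPer τ P L m Λs (cPer P L U₀ η m a Λs φ) φ =
      levFormPer τ P L m Λs (cPer P L U₀ η m a Λs φ) (qggqPer P L U₀ η m a Λs (cPer P L U₀ η m a Λs φ)) := by rw [qggqPer_cPer hb]
  rw [key]
  have hnn := levFormPer_qggqPer_self_nonneg τ hτt hτs hτp hUu hT hU hP hreg (cPer P L U₀ η m a Λs φ)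
  rcases hnn.lt_or_eq with hlt | heq
  · exact hlt
  · exact absurd (levFormPer_qggqPer_self_eq_zero τ hτt hτs hτp hUu hT hU hP hreg hinj heq.symm) hne

/-- `c(U₀)` IS SYMMETRIC for the level pairing. [cite: Balaban1985BackgroundPropagators, (3.25) p.394] -/
theorem levFormPer_cPer_symm [FiniteDimensional ℝ 𝔸] (hτt : ∀ a b : 𝔸, τ (a * b) = τ (b * a)) (hτs : ∀ a : 𝔸, τ (star a) = starRingEnd ℂ (τ a))
    (hτp : ∀ a : 𝔸, a ≠ 0 → 0 < (τ (star a * a)).re)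
    (hUu : ∀ (x : Site d) (κ : Fin d), U₀ x κ ∈ unitaryUnits 𝔸) (hT : ∀ (j : ℕ) (z y : Site d), bgT L U₀ j z y ∈ unitaryUnits 𝔸)
    (hU : IsPeriodic P U₀) (hP : L ^ m ∣ P) (hreg : RegularPrimePer L U₀ η m a Λs P) (hinj : QprimeStarPerInjective P L U₀ m Λs)
    (φ ψ : levPer (𝔸 := 𝔸) (d := d) P L m Λs) :
    levFormPer τ P L m Λs (cPer P L U₀ η m a Λs φ) ψ = levFormPer τ P L m Λs φ (cPer P L U₀ η m a Λs ψ) := by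
  have hb := qggqPer_bijective τ hτt hτs hτp hUu hT hU hP hreg hinj (η := η) (a := a)
  have hsym := levFormPer_isSymm τ P L m Λs hτs
  calc levFormPer τ P L m Λs (cPer P L U₀ η m a Λs φ) ψ
      = levFormPer τ P L m Λs (cPer P L U₀ η m a Λs φ) (qggqPer P L U₀ η m a Λs (cPer P L U₀ η m a Λs ψ)) := by rw [qggqPer_cPer hb]
    _ = levFormPer τ P L m Λs (cPer P L U₀ η m a Λs ψ) (qggqPer P L U₀ η m a Λs (cPer P L U₀ η m a Λs φ)) :=
        levFormPer_qggqPer_symm τ hτt hτs hUu hT hU hP hreg _ _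
    _ = levFormPer τ P L m Λs (cPer P L U₀ η m a Λs ψ) φ := by rw [qggqPer_cPer hb]
    _ = levFormPer τ P L m Λs φ (cPer P L U₀ η m a Λs ψ) := hsym.eq _ _

end Inverse

/-! ## §5  The torus members' geometry: one active level makes `Q′*` injective; A6 -/

section SingleLevel

variable {P L : ℕ} [NeZero P] [NeZero L] {U₀ : Site d → Fin d → 𝔸ˣ} {m : ℕ} {Λs : ℕ → Set (Site d)}

/-- conjugation by a unit is injective: `R(u)a = 0 ⟺ a = 0`. [folklore] -/
private theorem conjR_eq_zero_iff' (u : 𝔸ˣ) (a : 𝔸) : conjR u a = 0 ↔ a = 0 := by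
  constructor
  · intro h
    have key : ((u⁻¹ : 𝔸ˣ) : 𝔸) * conjR u a * (u : 𝔸) = a := by
      simp only [conjR_apply, mul_assoc, Units.inv_mul, mul_one, Units.inv_mul_cancel_left]
    rw [← key, h, mul_zero, zero_mul]
  · rintro rfl
    rw [conjR_apply, mul_zero, zero_mul]

/-- one transpose step reads the coarse datum at the block of the fine site, conjugated by a unit and scaled by `L⁻ᵈ ≠ 0`: it vanishes only where the datum does.
[cite: Balaban1985BackgroundPropagators, (3.19) p.393] -/
theorem qprimeT1_eq_zero_iff (j : ℕ) (ν : Site d → 𝔸) (x : Site d) :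
    B8Eq138LandauZd.qprimeT1 L U₀ j ν x = 0 ↔ ν (Literature.MathematicalPhysics.QuantumLattice.blockMap L x) = 0 := by
  have hL : ((L : ℝ) ^ d)⁻¹ ≠ 0 := inv_ne_zero (pow_ne_zero _ (by exact_mod_cast NeZero.ne L))
  rw [B8Eq138LandauZd.qprimeT1, smul_eq_zero, or_iff_right hL, conjR_eq_zero_iff']

/-- the level quotient one step up: `P∕Lʲ = L·(P∕Lʲ⁺¹)` for `Lʲ⁺¹ ∣ P`. [cite: Balaban1985RegularSpaces, p.77 (bookkeeping)] -/
theorem div_pow_eq_mul_div_pow_succ {P j : ℕ} (hP : L ^ (j + 1) ∣ P) : P / L ^ j = L * (P / L ^ (j + 1)) := by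
  obtain ⟨c, rfl⟩ := hP
  have hL0 : 0 < L := Nat.pos_of_ne_zero (NeZero.ne L)
  rw [Nat.mul_div_cancel_left _ (pow_pos hL0 (j + 1)), pow_succ, mul_assoc, Nat.mul_div_cancel_left _ (pow_pos hL0 j)]

/-- **THE ITERATED TRANSPOSE `Q′_jᵀν` VANISHES ON THE FINE CELL ONLY IF `ν` VANISHES ON THE LEVEL-`j` CELL** (`Lʲ ∣ P`: the blocks of the level cell are read by
the fine cell — the companion's cell tiling). [cite: Balaban1985BackgroundPropagators, (3.19) p.393; Balaban1985Averaging, (2)–(3) p.17] -/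
theorem eq_zero_on_box_of_QprimeT_eq_zero : ∀ (j : ℕ) {P : ℕ} (_ : L ^ j ∣ P) (ν : Site d → 𝔸),
    (∀ x ∈ box (d := d) P, QprimeT L U₀ j ν x = 0) → ∀ y ∈ box (d := d) (P / L ^ j), ν y = 0 := by
  intro j
  induction j with
  | zero =>
    intro P _ ν h y hy
    rw [pow_zero, Nat.div_one] at hy
    exact h y hy
  | succ j ih =>
    intro P hP ν h z hz
    have hPj : L ^ j ∣ P := (pow_dvd_pow L (Nat.le_succ j)).trans hP
    have h1 : ∀ y ∈ box (d := d) (P / L ^ j), B8Eq138LandauZd.qprimeT1 L U₀ j ν y = 0 := ih hPj (B8Eq138LandauZd.qprimeT1 L U₀ j ν) h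
    have hy : Literature.MathematicalPhysics.QuantumLattice.blockBase L z ∈ box (d := d) (P / L ^ j) := by
      rw [div_pow_eq_mul_div_pow_succ hP, B9Eq321LandauOrthogonalZdPer.mem_box_mul_iff_blockMap_mem_box,
        Literature.MathematicalPhysics.QuantumLattice.blockMap_blockBase]
      exact hz
    have := (qprimeT1_eq_zero_iff j ν (Literature.MathematicalPhysics.QuantumLattice.blockBase L z)).1 (h1 _ hy)
    rwa [Literature.MathematicalPhysics.QuantumLattice.blockMap_blockBase] at this

/-- ★ **ONE ACTIVE LEVEL MAKES `Q′*` INJECTIVE AT EVERY BACKGROUND OF UNITS** — the torus members' geometry (`Λ_j` void at the representatives for `j ≠ j₀`, anything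
at `j₀`, e.g. `ℤᵈ`): `Q′*φ = Q′_{j₀}ᵀφ_{j₀}` on the cell, the transpose stencil vanishes on the fine cell only if the level datum vanishes on the level cell, and the
level datum is `(P∕L^{j₀})`-periodic (`Lᵐ ∣ P`, `P ≠ 0`). [cite: Balaban1985BackgroundPropagators, (3.18)–(3.19) p.393, (3.25) p.394; Balaban1985RegularSpaces, (1.28) p.81, p.77 («Ω_j = T_η»)] -/
theorem qprimeStarPerInjective_of_single_level (hP : L ^ m ∣ P) {j₀ : ℕ} (hj₀ : j₀ ≤ m)
    (hoff : ∀ j, j ≤ m → j ≠ j₀ → ∀ y, ¬ InSat P L Λs j y) : QprimeStarPerInjective (𝔸 := 𝔸) (d := d) P L U₀ m Λs := by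
  intro φ ψ h
  rw [← sub_eq_zero] at h ⊢
  rw [← map_sub] at h
  set χ := φ - ψ with hχ
  have hlev : ∀ j, j ≤ m → j ≠ j₀ → ∀ y, (χ : ℕ × Site d → 𝔸) (j, y) = 0 := fun j hj hne y => χ.2.2 (j, y) fun h' => hoff j hj hne y h'.2
  -- on the cell `Q′*χ` is the single-level transpose stencil
  have hQT : ∀ x, QT L m (fun _ => (Set.univ : Set (Site d))) U₀ (fun j y => (χ : ℕ × Site d → 𝔸) (j, y)) x =
      QprimeT L U₀ j₀ (fun y => (χ : ℕ × Site d → 𝔸) (j₀, y)) x := by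
    intro x
    rw [QT, Finset.sum_eq_single j₀ (fun j hj hne => ?_) (fun h' => absurd (Finset.mem_range.2 (Nat.lt_succ_of_le hj₀)) h')]
    · rw [Set.indicator_univ]
    · have h0 : (Set.univ : Set (Site d)).indicator (fun y => (χ : ℕ × Site d → 𝔸) (j, y)) = 0 := by
        funext y
        rw [Set.indicator_univ, hlev j (Nat.lt_succ_iff.1 (Finset.mem_range.1 hj)) hne y, Pi.zero_apply]
      rw [h0, B8Eq138LandauZd.QprimeT_zero]
  have hcell : ∀ x ∈ box (d := d) P, QprimeT L U₀ j₀ (fun y => (χ : ℕ × Site d → 𝔸) (j₀, y)) x = 0 := by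
    intro x hx
    have := congrArg (fun g : perSub (𝔸 := 𝔸) (d := d) P => (g : Site d → 𝔸) x) h
    simp only [Submodule.coe_zero, Pi.zero_apply] at this
    rwa [QprimeStarPer_coe_apply_of_mem_box P L U₀ m Λs χ hx, hQT x] at this
  -- the level datum vanishes on the level cell, hence everywhere by level periodicity
  have hbox := eq_zero_on_box_of_QprimeT_eq_zero (U₀ := U₀) j₀ ((pow_dvd_pow L hj₀).trans hP) _ hcell
  haveI := neZero_div_pow (P := P) hP hj₀
  have hχ0 : ∀ y, (χ : ℕ × Site d → 𝔸) (j₀, y) = 0 := by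
    intro y
    have hper : (χ : ℕ × Site d → 𝔸) (j₀, tlift (tcls (P / L ^ j₀) y)) = (χ : ℕ × Site d → 𝔸) (j₀, y) := IsPeriodic.apply_tlift (χ.2.1 j₀) y
    rw [← hper]
    exact hbox _ (tlift_mem_box _)
  apply Subtype.ext
  funext p
  obtain ⟨j, y⟩ := p
  rw [Submodule.coe_zero, Pi.zero_apply]
  by_cases hjm : j ≤ m
  · by_cases hj : j = j₀
    · subst hj; exact hχ0 y
    · exact hlev j hjm hj y
  · exact χ.2.2 (j, y) fun h' => hjm h'.1

end SingleLevel

end Literature.MathematicalPhysics.QuantumFieldTheory.Balaban1983to89.B9Eq325QGGQInvZdPer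

end
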